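import Mathlib
import Summits.ResolutionOfSingularities.ResolutionOfSingularities.Theorems.WildQuotientsWildQuotientResolutionJordanThreeK3Charts
import Summits.ResolutionOfSingularities.ResolutionOfSingularities.Theorems.WildQuotientsWildQuotientResolutionJordanFiveFrameDefs

/-!
# RUNG V5 brick B8 (divisorial half, algebra): the augmentation ideal over the terminal chart
# `D₊(x_d¹² t)` of `Bl_{I₁₂} 𝔸ⁿ` is `(x_d)`, in ANY Rees chart — any characteristic

(crux stmt-ResolutionOfSingularities-15640 `WildQuotients.WildQuotientResolution`, line `Sketch`;
chain w45c NEXT RUNG R-T / RUNG V5, binder `HdivD` of res-L1-w45c-lead-1's scaffold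
`JordanFive.jordanFive_hasResolution_of_bricks` (`L/res-L1-w45c-lead-1/stubs/J5Bricks.lean` l.72–86;
plan-1 RULING 2026-08-27T10:54:44Z: B8 = res-L1-w45c-stub-3); the `J₅` twins of stub-2's
`JordanFour.chartC_span_eq` (…JordanFourChartCAug) and stub-4's `JordanFour.I6.chart_span_eq` /
`I6.chart_isPrincipal` (…JordanFourI6ChartAlgebra). [OURS · L1 W4.5c] — NOT a statement of any
manuscript; replaces the role of no printed item.)

Pure commutative algebra in a domain `S` (no scheme): `xa, xb, xc, xd ∈ S`, `xd ≠ 0`, a ring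
endomorphism `a` of `J₅`-type — `a xa = xa`, `a xb = xb + m xa`, `a xc = xc + m xb + m′ xa`,
`a xd = xd + m xc + m′ xb + m″ xa` (every `g ∈ ⟨σ⟩` acts so, `JordanFive.pow_apply_X_*`) — and the
40 monomials `K_l = xa^α xb^β xc^γ xd^δ`, `(α,β,γ,δ) = JordanFive.exps12 l` (the generators of `I₁₂`
evaluated in `S`; `K₃ = xd¹²`).

* `JordanFive.chartD_span_eq` — if `xd¹² · e_l = K_l` (`l ≠ 3`; the Rees chart `D₊(x_d¹²t)`:
  `e₁₇ = u_a`, `e₂₈ = u_b`, `e₃₃ = u_c` with `xa = xd⁴u_a`, `xb = xd³u_b`, `xc = xd²u_c`, and every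
  `e_l = u_a^α u_b^β u_c^γ xd^{w−12}`), then `(xa, xb, xc, xd) + (a e_l − e_l)_l = (xd)`: the action is
  `a xd = xd·w` with `w ≡ 1 (mod xd)`, `w⁴·a u_a = u_a`, `w³·a u_b = u_b + m xd u_a`,
  `w²·a u_c = u_c + m xd u_b + m′ xd² u_a`, so every move lies in `(xd)`.
* `JordanFive.I12.chart_span_eq` / `I12.chart_isPrincipal` — the same read in ANY Rees chart `j`:
  with `T = K_j ≠ 0`, `T · U_l = K_l` and every `K_l ∈ (xd¹²)` (the point lies over the terminal
  chart), `(xa, xb, xc, xd) + (a U_l − U_l : l ≠ j) = (xd)` — in particular principal. This is the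
  Király–Lütkebohmert input making the terminal quotient piece `O₃/G` regular.
-/

-- single-problem summit: the doubled namespace component `ResolutionOfSingularities` is forced
set_option linter.dupNamespace false

noncomputable section

namespace Summit.ResolutionOfSingularities.ResolutionOfSingularities.Theorems.WildQuotientResolution.JordanFive

open JordanThree

/-- Every entry of `exps12` has `(4,3,2,1)`-weight `≥ 12` (restated locally to keep this file
independent of `…JordanFiveChartD`). -/
private theorem twelve_le_weight (j : Fin 40) :
    12 ≤ 4 * (exps12 j).1 + 3 * (exps12 j).2.1 + 2 * (exps12 j).2.2.1 + (exps12 j).2.2.2 := by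
  fin_cases j <;> simp [exps12]

/-- **Chart `D₊(x_d¹² t)` of `Bl_{I₁₂}`, augmentation ideal `(x_d)`** (any characteristic, any
`m, m′, m″`): see the module docstring. [OURS · L1 W4.5c] [folklore] -/
theorem chartD_span_eq {S : Type} [CommRing S] [IsDomain S] (xa xb xc xd m m' m'' : S)
    (hxd : xd ≠ 0) (a : S →+* S) (ha : a xa = xa) (hb : a xb = xb + m * xa)
    (hc : a xc = xc + m * xb + m' * xa) (hd : a xd = xd + m * xc + m' * xb + m'' * xa)
    (e : {l : Fin 40 // l ≠ (3 : Fin 40)} → S)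
    (he : ∀ l, xd ^ 12 * e l = xa ^ (exps12 l.1).1 * xb ^ (exps12 l.1).2.1 *
      xc ^ (exps12 l.1).2.2.1 * xd ^ (exps12 l.1).2.2.2) :
    Ideal.span ({xa, xb, xc, xd} : Set S) ⊔ Ideal.span (Set.range fun l => a (e l) - e l) =
      Ideal.span ({xd} : Set S) := by
  set ua : S := e ⟨17, by decide⟩ with hua
  set ub : S := e ⟨28, by decide⟩ with hub
  set uc : S := e ⟨33, by decide⟩ with huc
  have h17 : xd ^ 12 * ua = xa * xd ^ 8 := by
    have h := he ⟨17, by decide⟩; simpa [exps12] using h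
  have h28 : xd ^ 12 * ub = xb * xd ^ 9 := by
    have h := he ⟨28, by decide⟩; simpa [exps12] using h
  have h33 : xd ^ 12 * uc = xc * xd ^ 10 := by
    have h := he ⟨33, by decide⟩; simpa [exps12] using h
  -- the monomial parametrisation `xa = xd⁴ u_a`, `xb = xd³ u_b`, `xc = xd² u_c`
  have hxa : xd ^ 4 * ua = xa := by
    have h : xd ^ 8 * (xd ^ 4 * ua) = xd ^ 8 * xa := by linear_combination h17
    exact mul_left_cancel₀ (pow_ne_zero 8 hxd) h
  have hxb : xd ^ 3 * ub = xb := by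
    have h : xd ^ 9 * (xd ^ 3 * ub) = xd ^ 9 * xb := by linear_combination h28
    exact mul_left_cancel₀ (pow_ne_zero 9 hxd) h
  have hxc : xd ^ 2 * uc = xc := by
    have h : xd ^ 10 * (xd ^ 2 * uc) = xd ^ 10 * xc := by linear_combination h33
    exact mul_left_cancel₀ (pow_ne_zero 10 hxd) h
  -- every `e l` is the monomial `u_a^α u_b^β u_c^γ xd^{w-12}`
  have hel : ∀ l : {l : Fin 40 // l ≠ (3 : Fin 40)},
      e l = ua ^ (exps12 l.1).1 * ub ^ (exps12 l.1).2.1 * uc ^ (exps12 l.1).2.2.1 *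
        xd ^ (4 * (exps12 l.1).1 + 3 * (exps12 l.1).2.1 + 2 * (exps12 l.1).2.2.1 +
          (exps12 l.1).2.2.2 - 12) := by
    intro l
    have hw := twelve_le_weight l.1
    set α := (exps12 l.1).1
    set β := (exps12 l.1).2.1
    set γ := (exps12 l.1).2.2.1
    set δ := (exps12 l.1).2.2.2
    have hN : 4 * α + 3 * β + 2 * γ + δ - 12 + 12 = 4 * α + 3 * β + 2 * γ + δ := Nat.sub_add_cancel hw
    have h := he l
    rw [← hxa, ← hxb, ← hxc] at h
    have h2 : xd ^ 12 * e l =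
        xd ^ 12 * (ua ^ α * ub ^ β * uc ^ γ * xd ^ (4 * α + 3 * β + 2 * γ + δ - 12)) := by
      rw [h]
      have e1 : xd ^ 12 * (ua ^ α * ub ^ β * uc ^ γ * xd ^ (4 * α + 3 * β + 2 * γ + δ - 12)) =
          ua ^ α * ub ^ β * uc ^ γ * xd ^ (4 * α + 3 * β + 2 * γ + δ - 12 + 12) := by ring
      rw [e1, hN]
      ring
    exact mul_left_cancel₀ (pow_ne_zero 12 hxd) h2
  -- the action: `a xd = xd · w`, `w ≡ 1 (mod xd)`
  set t : S := m * uc + m' * (xd * ub) + m'' * (xd ^ 2 * ua) with ht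
  set w : S := 1 + xd * t with hw
  have hw1 : w - 1 = xd * t := by rw [hw]; ring
  have hd' : a xd = xd * w := by rw [hd, ← hxa, ← hxb, ← hxc, hw, ht]; ring
  have hau : a ua * w ^ 4 = ua := by
    have h := congrArg a hxa
    rw [map_mul, map_pow, ha, hd', ← hxa] at h
    have h' : xd ^ 4 * (a ua * w ^ 4) = xd ^ 4 * ua := by linear_combination h
    exact mul_left_cancel₀ (pow_ne_zero 4 hxd) h'
  have hbu : a ub * w ^ 3 = ub + m * (xd * ua) := by
    have h := congrArg a hxb
    rw [map_mul, map_pow, hb, hd', ← hxa, ← hxb] at h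
    have h' : xd ^ 3 * (a ub * w ^ 3) = xd ^ 3 * (ub + m * (xd * ua)) := by linear_combination h
    exact mul_left_cancel₀ (pow_ne_zero 3 hxd) h'
  have hcu : a uc * w ^ 2 = uc + m * (xd * ub) + m' * (xd ^ 2 * ua) := by
    have h := congrArg a hxc
    rw [map_mul, map_pow, hc, hd', ← hxa, ← hxb, ← hxc] at h
    have h' : xd ^ 2 * (a uc * w ^ 2) = xd ^ 2 * (uc + m * (xd * ub) + m' * (xd ^ 2 * ua)) := by
      linear_combination h
    exact mul_left_cancel₀ (pow_ne_zero 2 hxd) h'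
  -- the moves land in `(x_d)`
  set I : Ideal S := Ideal.span ({xd} : Set S) with hI
  have hxdI : xd ∈ I := Ideal.subset_span (Set.mem_singleton _)
  have hmxd : a xd - xd ∈ I := Ideal.mem_span_singleton'.mpr ⟨w - 1, by rw [hd']; ring⟩
  have hmua : a ua - ua ∈ I := by
    refine Ideal.mem_span_singleton'.mpr ⟨-(a ua * (t * (w ^ 3 + w ^ 2 + w + 1))), ?_⟩
    linear_combination (-1 : S) * hau + a ua * (w ^ 3 + w ^ 2 + w + 1) * hw1
  have hmub : a ub - ub ∈ I := by
    refine Ideal.mem_span_singleton'.mpr ⟨m * ua - a ub * (t * (w ^ 2 + w + 1)), ?_⟩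
    linear_combination (-1 : S) * hbu + a ub * (w ^ 2 + w + 1) * hw1
  have hmuc : a uc - uc ∈ I := by
    refine Ideal.mem_span_singleton'.mpr ⟨m * ub + m' * (xd * ua) - a uc * (t * (w + 1)), ?_⟩
    linear_combination (-1 : S) * hcu + a uc * (w + 1) * hw1
  apply le_antisymm
  · refine sup_le ?_ ?_
    · refine Ideal.span_le.mpr ?_
      intro x hx
      simp only [Set.mem_insert_iff, Set.mem_singleton_iff] at hx
      rcases hx with rfl | rfl | rfl | rfl
      · rw [← hxa]
        exact Ideal.mem_span_singleton'.mpr ⟨xd ^ 3 * ua, by ring⟩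
      · rw [← hxb]
        exact Ideal.mem_span_singleton'.mpr ⟨xd ^ 2 * ub, by ring⟩
      · rw [← hxc]
        exact Ideal.mem_span_singleton'.mpr ⟨xd * uc, by ring⟩
      · exact hxdI
    · refine Ideal.span_le.mpr ?_
      rintro _ ⟨l, rfl⟩
      change a (e l) - e l ∈ I
      rw [hel l]
      exact map_mul_sub_mul_mem a I
        (map_mul_sub_mul_mem a I
          (map_mul_sub_mul_mem a I (map_pow_sub_pow_mem a I hmua _) (map_pow_sub_pow_mem a I hmub _))
          (map_pow_sub_pow_mem a I hmuc _))
        (map_pow_sub_pow_mem a I hmxd _)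
  · rw [hI, Ideal.span_singleton_le_iff_mem]
    exact Ideal.mem_sup_left (Ideal.subset_span
      (Set.mem_insert_of_mem _ (Set.mem_insert_of_mem _ (Set.mem_insert_of_mem _
        (Set.mem_singleton _)))))

/-- **The augmentation ideal over the terminal chart, read in ANY Rees chart `j`**: in a domain `S`
with a `J₅`-type endomorphism `a`, let `K l = xa^α xb^β xc^γ xd^δ` (`(α,β,γ,δ) = exps12 l`) be the
generators of `I₁₂` evaluated in `S`, `T = K_j ≠ 0` and `T · U_l = K_l` the Rees-chart relations; if
every `K_l` is a multiple of `xd¹²` (the point lies over the terminal chart `D₊(x_d¹²t)`), then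
`(xa, xb, xc, xd) + (a U_l − U_l : l ≠ j) = (xd)`. [OURS · L1 W4.5c] [folklore] -/
theorem I12.chart_span_eq {S : Type} [CommRing S] [IsDomain S] (xa xb xc xd T m m' m'' : S)
    (K U : Fin 40 → S)
    (hK : ∀ l, K l = xa ^ (exps12 l).1 * xb ^ (exps12 l).2.1 * xc ^ (exps12 l).2.2.1 *
      xd ^ (exps12 l).2.2.2)
    (a : S →+* S) (ha : a xa = xa) (hb : a xb = xb + m * xa)
    (hc : a xc = xc + m * xb + m' * xa) (hd : a xd = xd + m * xc + m' * xb + m'' * xa)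
    (hT : T ≠ 0) (j : Fin 40) (hTj : T = K j) (hU : ∀ l, T * U l = K l)
    (hmem : ∀ l, K l ∈ Ideal.span ({xd ^ 12} : Set S)) :
    Ideal.span ({xa, xb, xc, xd} : Set S) ⊔
      Ideal.span (Set.range fun l : {l : Fin 40 // l ≠ j} => a (U l) - U l) =
      Ideal.span ({xd} : Set S) := by
  classical
  have hK3 : K 3 = xd ^ 12 := by rw [hK]; simp [exps12]
  -- `e l` with `x_d¹² e l = K l`
  choose e' he' using fun l => Ideal.mem_span_singleton'.mp (hmem l)
  let e : {l : Fin 40 // l ≠ (3 : Fin 40)} → S := fun l => e' l.1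
  have hxd : xd ≠ 0 := by
    intro h0
    apply hT
    have h := he' j
    rw [← hTj, h0, zero_pow (by norm_num), mul_zero] at h
    exact h.symm
  have he : ∀ l : {l : Fin 40 // l ≠ (3 : Fin 40)}, xd ^ 12 * e l =
      xa ^ (exps12 l.1).1 * xb ^ (exps12 l.1).2.1 * xc ^ (exps12 l.1).2.2.1 *
        xd ^ (exps12 l.1).2.2.2 := fun l => by
    rw [mul_comm, ← hK]; exact he' l.1
  have hA := chartD_span_eq xa xb xc xd m m' m'' hxd a ha hb hc hd e he
  have hxd12 : xd ^ 12 ≠ 0 := pow_ne_zero 12 hxd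
  -- `w := e' j`, `T = w · x_d¹²`, `U 3 = w⁻¹`
  have hTw : T = e' j * xd ^ 12 := by rw [hTj]; exact (he' j).symm
  have hwU3 : e' j * U 3 = 1 := by
    have h := hU 3
    rw [hK3, hTw] at h
    exact mul_right_cancel₀ hxd12 (by rw [one_mul]; linear_combination h)
  have haw : a (e' j) * a (U 3) = 1 := by rw [← map_mul, hwU3, map_one]
  -- `U l = U 3 · e' l`
  have hUl : ∀ l, U l = U 3 * e' l := by
    intro l
    have h := hU l
    rw [← he' l, hTw] at h
    have h2 : xd ^ 12 * (e' j * U l) = xd ^ 12 * e' l := by linear_combination h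
    have h3 := mul_left_cancel₀ hxd12 h2
    calc U l = (e' j * U 3) * U l := by rw [hwU3, one_mul]
      _ = U 3 * (e' j * U l) := by ring
      _ = U 3 * e' l := by rw [h3]
  have hw1_of : j = 3 → e' j = 1 := fun hj => by
    subst hj
    have h := he' 3
    rw [hK3] at h
    exact mul_right_cancel₀ hxd12 (by rw [one_mul]; exact h)
  -- the two augmentation ideals coincide
  have hgen3 : a (U 3) - U 3 ∈ Ideal.span ({xa, xb, xc, xd} : Set S) ⊔
      Ideal.span (Set.range fun l : {l : Fin 40 // l ≠ (3 : Fin 40)} => a (e l) - e l) := by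
    by_cases hj : j = 3
    · have hU3 : U 3 = 1 := by
        have h := hwU3; rw [hw1_of hj, one_mul] at h; exact h
      rw [hU3, map_one, sub_self]
      exact Ideal.zero_mem _
    · have e1 : a (U 3) - U 3 = -(a (U 3) * U 3) * (a (e ⟨j, hj⟩) - e ⟨j, hj⟩) := by
        change a (U 3) - U 3 = -(a (U 3) * U 3) * (a (e' j) - e' j)
        linear_combination (U 3) * haw - (a (U 3)) * hwU3
      rw [e1]
      exact Ideal.mul_mem_left _ _ (Ideal.mem_sup_right (Ideal.subset_span ⟨⟨j, hj⟩, rfl⟩))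
  rw [← hA]
  apply le_antisymm
  · refine sup_le le_sup_left ?_
    rw [Ideal.span_le]
    rintro _ ⟨⟨l, hl⟩, rfl⟩
    change a (U l) - U l ∈ _
    by_cases hl3 : l = 3
    · subst hl3; exact hgen3
    · have e1 : a (U l) - U l =
          a (U 3) * (a (e ⟨l, hl3⟩) - e ⟨l, hl3⟩) + (a (U 3) - U 3) * e ⟨l, hl3⟩ := by
        change a (U l) - U l = a (U 3) * (a (e' l) - e' l) + (a (U 3) - U 3) * e' l
        rw [hUl l, map_mul]; ring
      rw [e1]
      exact Ideal.add_mem _ (Ideal.mul_mem_left _ _ (Ideal.mem_sup_right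
        (Ideal.subset_span ⟨⟨l, hl3⟩, rfl⟩))) (Ideal.mul_mem_right _ _ hgen3)
  · refine sup_le le_sup_left ?_
    rw [Ideal.span_le]
    rintro _ ⟨⟨l, hl3⟩, rfl⟩
    change a (e' l) - e' l ∈ _
    have hel : e' l = e' j * U l := by
      rw [hUl l, ← mul_assoc, hwU3, one_mul]
    by_cases hj3 : j = 3
    · rw [hw1_of hj3, one_mul] at hel
      have hlj : l ≠ j := by rw [hj3]; exact hl3
      rw [hel]
      exact Ideal.mem_sup_right (Ideal.subset_span ⟨⟨l, hlj⟩, rfl⟩)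
    · have h3j : (3 : Fin 40) ≠ j := fun h => hj3 h.symm
      have haw' : a (e' j) - e' j ∈ Ideal.span ({xa, xb, xc, xd} : Set S) ⊔
          Ideal.span (Set.range fun l : {l : Fin 40 // l ≠ j} => a (U l) - U l) := by
        have e1 : a (e' j) - e' j = -(a (e' j) * e' j) * (a (U 3) - U 3) := by
          linear_combination (e' j) * haw - (a (e' j)) * hwU3
        rw [e1]
        exact Ideal.mul_mem_left _ _ (Ideal.mem_sup_right (Ideal.subset_span ⟨⟨3, h3j⟩, rfl⟩))
      by_cases hlj : l = j
      · subst hlj; exact haw'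
      · have e1 : a (e' l) - e' l = a (e' j) * (a (U l) - U l) + (a (e' j) - e' j) * U l := by
          rw [hel, map_mul]; ring
        rw [e1]
        exact Ideal.add_mem _ (Ideal.mul_mem_left _ _ (Ideal.mem_sup_right
          (Ideal.subset_span ⟨⟨l, hlj⟩, rfl⟩))) (Ideal.mul_mem_right _ _ haw')

/-- **Corollary: the ideal is principal.** [OURS · L1 W4.5c] [folklore] -/
theorem I12.chart_isPrincipal {S : Type} [CommRing S] [IsDomain S] (xa xb xc xd T m m' m'' : S)
    (K U : Fin 40 → S)
    (hK : ∀ l, K l = xa ^ (exps12 l).1 * xb ^ (exps12 l).2.1 * xc ^ (exps12 l).2.2.1 *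
      xd ^ (exps12 l).2.2.2)
    (a : S →+* S) (ha : a xa = xa) (hb : a xb = xb + m * xa)
    (hc : a xc = xc + m * xb + m' * xa) (hd : a xd = xd + m * xc + m' * xb + m'' * xa)
    (hT : T ≠ 0) (j : Fin 40) (hTj : T = K j) (hU : ∀ l, T * U l = K l)
    (hmem : ∀ l, K l ∈ Ideal.span ({xd ^ 12} : Set S)) :
    (Ideal.span ({xa, xb, xc, xd} : Set S) ⊔
      Ideal.span (Set.range fun l : {l : Fin 40 // l ≠ j} => a (U l) - U l)).IsPrincipal := by
  rw [I12.chart_span_eq xa xb xc xd T m m' m'' K U hK a ha hb hc hd hT j hTj hU hmem]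
  exact ⟨⟨xd, rfl⟩⟩

end Summit.ResolutionOfSingularities.ResolutionOfSingularities.Theorems.WildQuotientResolution.JordanFive

end
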